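import Summits.Ventures.WeilGRH.TwistedGramOddComplex
import Literature.Analysis.SpecialFunctions.SechCosineTransform
import Mathlib.MeasureTheory.Integral.Prod
import HarnessLib

/-!
# GRH arm (rh-explicit, venture WeilGRH): the PARITY BONUS is non-negative on window functions —
  odd characters are certified by the EVEN-parity Gram matrices

Cell `rh-explicit`, WEIL TRACK — GRH ARM (typing seat weil-grh-1).  By `TwistedSechDensity.lean` /
`TwistedGramOddComplex.lean` the twisted window form of an odd character is the even-parity expression plus
`B(u) = π‖u‖₂² − ∫₀^∞ D_t(u) dt/(2cosh(t/2))`.  Here, for every bounded measurable `u` vanishing off `[-a,a]`,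
  `B(u) = ∫_ℝ (‖∫ cos(ωy) u(y) dy‖² + ‖∫ sin(ωy) u(y) dy‖²) dω/(2cosh(πω)) ≥ 0`  (`parity_bonus_eq`, `parity_bonus_nonneg`),
from `1/(2cosh(t/2)) = ∫_ℝ cos(tω) dω/(2cosh(πω))` (`Literature…SechCosineTransform.integral_univ_cos_div_cosh`),
`D_t(u) = 2‖u‖₂² − 2 Re ∫ u(x+t) conj u(x) dx` and Fubini.  CONSEQUENCE: positivity certificates may IGNORE the
parity — for `a_χ = 1` the rung follows from positive semidefiniteness of the EVEN-parity matrices (Yoshida's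
digamma-node entries, no `sech` integrals): `weilPositivityOnChar_of_twistedGramCoeff_sector_psd_odd` (real odd χ,
`twistedGramCoeff χ a`), `weilPositivityOnChar_of_twistedGramCoeffC_psd_odd` (complex odd χ, `twistedGramCoeffC χ a`).
No definitions; no named facts; RH/GRH-free.
-/

set_option autoImplicit false

noncomputable section

open Complex Filter Set MeasureTheory
open scoped Real Topology ComplexConjugate ArithmeticFunction.vonMangoldt

namespace Summit.Ventures.WeilGRH

open Literature.NumberTheory.LFunctions
open Literature.NumberTheory.LFunctions.Yoshida1992 (modes chi freq gramCoeff polarCoeff incrCoeff)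
open Summit.RiemannHypothesis.RiemannHypothesis.Theorems.WeilFormatC

variable {q : ℕ} {a S : ℝ} {u : ℝ → ℂ}

/-! ## `σ` as the cosine transform of the positive weight `1/(2cosh(πω))` -/

/-- **`1/(2cosh(t/2)) = ∫_ℝ cos(tω) dω/(2cosh(πω))`.** -/
theorem sech_density_eq_integral_cos (t : ℝ) :
    1 / (2 * Real.cosh (t / 2)) = ∫ ω, Real.cos (t * ω) / (2 * Real.cosh (π * ω)) := by
  have h := Literature.Analysis.SpecialFunctions.integral_univ_cos_div_cosh Real.pi_pos t
  have e : π * t / (2 * π) = t / 2 := by rw [mul_comm π t, mul_div_mul_right _ _ Real.pi_pos.ne']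
  rw [div_self Real.pi_pos.ne', e] at h
  have hf : (fun ω ↦ Real.cos (t * ω) / (2 * Real.cosh (π * ω))) =
      fun ω ↦ (1 / 2) * (Real.cos (t * ω) / Real.cosh (π * ω)) := by
    funext ω; ring
  rw [hf, integral_const_mul, h]; ring

/-- The weight `1/(2cosh(πω))` is integrable (its integral is `1/2 ≠ 0`). -/
theorem integrable_sech_weight : Integrable fun ω : ℝ ↦ 1 / (2 * Real.cosh (π * ω)) := by
  have h := sech_density_eq_integral_cos 0
  simp only [zero_div, Real.cosh_zero, mul_one, zero_mul, Real.cos_zero] at h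
  exact Integrable.of_integral_ne_zero (by rw [← h]; norm_num)

/-- The weight is positive. -/
theorem sech_weight_pos (ω : ℝ) : 0 < 1 / (2 * Real.cosh (π * ω)) := by
  have := Real.cosh_pos (π * ω); positivity

/-- `σ(t) = 1/(2cosh(t/2))` is integrable on `ℝ` and `∫_ℝ σ = π` (cosine transform at frequency `0`). -/
theorem integral_sech_density : ∫ t : ℝ, 1 / (2 * Real.cosh (t / 2)) = π := by
  have h := Literature.Analysis.SpecialFunctions.integral_univ_cos_div_cosh (by norm_num : (0 : ℝ) < 1 / 2) 0
  simp only [zero_mul, Real.cos_zero, mul_zero, zero_div, Real.cosh_zero, div_one] at h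
  have hf : (fun t : ℝ ↦ 1 / (2 * Real.cosh (t / 2))) = fun t ↦ (1 / 2) * (1 / Real.cosh (1 / 2 * t)) := by
    funext t; rw [show 1 / 2 * t = t / 2 by ring]; ring
  rw [hf, integral_const_mul, h]; ring

/-- `σ` is integrable on `ℝ`. -/
theorem integrable_sech_density : Integrable fun t : ℝ ↦ 1 / (2 * Real.cosh (t / 2)) :=
  Integrable.of_integral_ne_zero (by rw [integral_sech_density]; exact Real.pi_pos.ne')

/-! ## Window functions: integrability and the shift pairing `k_u(t) = ∫ u(x+t) conj u(x) dx` -/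

/-- A bounded measurable function vanishing off `[-a,a]` is integrable. -/
theorem integrable_window (hm : Measurable u) (hz : ∀ x, x ∉ Icc (-a) a → u x = 0)
    (hb : ∀ x, ‖u x‖ ≤ S) : Integrable u := by
  have hint : Integrable fun x ↦ (Icc (-a) a).indicator (fun _ ↦ S) x :=
    (integrable_indicator_iff measurableSet_Icc).2 (integrableOn_const (by simp [Real.volume_Icc]))
  refine hint.mono' hm.aestronglyMeasurable (Eventually.of_forall fun x ↦ ?_)
  by_cases hx : x ∈ Icc (-a) a
  · rw [indicator_of_mem hx]; exact hb x
  · rw [hz x hx, norm_zero, indicator_of_notMem hx]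

/-- The shift-pairing integrand is jointly measurable. -/
theorem measurable_shift_mul_conj_uncurry (hm : Measurable u) :
    Measurable fun p : ℝ × ℝ ↦ u (p.2 + p.1) * conj (u p.2) :=
  (hm.comp (measurable_snd.add measurable_fst)).mul (Complex.continuous_conj.measurable.comp (hm.comp measurable_snd))

/-- `t ↦ k_u(t)` is strongly measurable. -/
theorem aestronglyMeasurable_shift_integral (hm : Measurable u) :
    AEStronglyMeasurable (fun t : ℝ ↦ ∫ x, u (x + t) * conj (u x)) := by
  have h : StronglyMeasurable (Function.uncurry fun (t x : ℝ) ↦ u (x + t) * conj (u x)) :=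
    (measurable_shift_mul_conj_uncurry hm).stronglyMeasurable
  exact (h.integral_prod_right (ν := volume)).aestronglyMeasurable

/-- `‖k_u(t)‖ ≤ S·‖u‖₁`. -/
theorem norm_shift_integral_le (hm : Measurable u) (hz : ∀ x, x ∉ Icc (-a) a → u x = 0)
    (hb : ∀ x, ‖u x‖ ≤ S) (t : ℝ) : ‖∫ x, u (x + t) * conj (u x)‖ ≤ S * ∫ x, ‖u x‖ := by
  calc ‖∫ x, u (x + t) * conj (u x)‖ ≤ ∫ x, ‖u (x + t) * conj (u x)‖ := norm_integral_le_integral_norm _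
    _ ≤ ∫ x, S * ‖u x‖ := by
        refine integral_mono_of_nonneg (Eventually.of_forall fun x ↦ norm_nonneg _)
          ((integrable_window hm hz hb).norm.const_mul S) (Eventually.of_forall fun x ↦ ?_)
        simp only [norm_mul, Complex.norm_conj]
        exact mul_le_mul_of_nonneg_right (hb _) (norm_nonneg _)
    _ = S * ∫ x, ‖u x‖ := integral_const_mul _ _

/-- `k_u(t) = 0` for `|t| > 2a`. -/
theorem shift_integral_eq_zero (hz : ∀ x, x ∉ Icc (-a) a → u x = 0) {t : ℝ} (ht : 2 * a < |t|) :
    ∫ x, u (x + t) * conj (u x) = 0 := by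
  have h0 : (fun x ↦ u (x + t) * conj (u x)) = fun _ ↦ 0 := by
    funext x
    by_cases hx : x ∈ Icc (-a) a
    · have hxt : x + t ∉ Icc (-a) a := by
        intro hxt
        have h1 := hx.1; have h2 := hx.2; have h3 := hxt.1; have h4 := hxt.2
        rcases le_or_gt 0 t with h | h
        · rw [abs_of_nonneg h] at ht; linarith
        · rw [abs_of_neg h] at ht; linarith
      rw [hz _ hxt, zero_mul]
    · rw [hz x hx, map_zero, mul_zero]
  rw [h0, integral_zero]

/-- `D_t(u) = 2‖u‖₂² − 2 Re k_u(t)`. -/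
theorem weilIncrement_eq_of_window (hm : Measurable u) (hz : ∀ x, x ∉ Icc (-a) a → u x = 0)
    (hb : ∀ x, ‖u x‖ ≤ S) (t : ℝ) :
    weilIncrement u t = 2 * (∫ x, ‖u x‖ ^ 2) - 2 * (∫ x, u (x + t) * conj (u x)).re := by
  have h := weilTwistIncrement_eq_of_window hm hz hb 1 t
  rw [show weilTwistIncrement 1 u t = weilIncrement u t by simp [weilTwistIncrement, weilIncrement],
    map_one, one_mul, norm_one] at h
  rw [h]; ring

/-! ## The parity bonus as a positive integral -/

/-- **The bonus through the shift pairing**: `π‖u‖₂² − ∫₀^∞ σ D_t(u) = ∫_ℝ σ(t) Re k_u(t) dt`. -/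
theorem parity_bonus_eq_integral_shift (hm : Measurable u)
    (hz : ∀ x, x ∉ Icc (-a) a → u x = 0) (hb : ∀ x, ‖u x‖ ≤ S) :
    π * (∫ x, ‖u x‖ ^ 2) - ∫ t in Ioi (0 : ℝ), 1 / (2 * Real.cosh (t / 2)) * weilIncrement u t =
      ∫ t, 1 / (2 * Real.cosh (t / 2)) * (∫ x, u (x + t) * conj (u x)).re := by
  set N2 : ℝ := ∫ x, ‖u x‖ ^ 2
  set k : ℝ → ℂ := fun t ↦ ∫ x, u (x + t) * conj (u x) with hk
  have hσi : Integrable fun t : ℝ ↦ 1 / (2 * Real.cosh (t / 2)) := integrable_sech_density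
  have hσπ : ∫ t, 1 / (2 * Real.cosh (t / 2)) = π := integral_sech_density
  have hkb : ∀ t, ‖(k t).re‖ ≤ S * ∫ x, ‖u x‖ := fun t ↦
    (abs_re_le_norm _).trans (norm_shift_integral_le hm hz hb t)
  have hσk : Integrable fun t : ℝ ↦ 1 / (2 * Real.cosh (t / 2)) * (k t).re := by
    refine (hσi.mul_const (S * ∫ x, ‖u x‖)).mono'
      (continuous_sech_density.aestronglyMeasurable.mul
        (Complex.continuous_re.comp_aestronglyMeasurable (aestronglyMeasurable_shift_integral hm)))
      (Eventually.of_forall fun t ↦ ?_)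
    rw [norm_mul, Real.norm_of_nonneg (sech_density_pos t).le]
    exact mul_le_mul_of_nonneg_left (hkb t) (sech_density_pos t).le
  have hD : ∀ t, weilIncrement u t = 2 * N2 - 2 * (k t).re := fun t ↦ weilIncrement_eq_of_window hm hz hb t
  have hσD : Integrable fun t : ℝ ↦ 1 / (2 * Real.cosh (t / 2)) * weilIncrement u t := by
    have : (fun t : ℝ ↦ 1 / (2 * Real.cosh (t / 2)) * weilIncrement u t) =
        fun t ↦ (2 * N2) * (1 / (2 * Real.cosh (t / 2))) - 2 * (1 / (2 * Real.cosh (t / 2)) * (k t).re) := by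
      funext t; rw [hD t]; ring
    rw [this]
    exact (hσi.const_mul _).sub (hσk.const_mul _)
  have heven : ∀ t : ℝ, 1 / (2 * Real.cosh (-t / 2)) * weilIncrement u (-t) =
      1 / (2 * Real.cosh (t / 2)) * weilIncrement u t := fun t ↦ by
    rw [neg_div, Real.cosh_neg, weilIncrement_neg]
  have hhalf : ∫ t in Ioi (0 : ℝ), 1 / (2 * Real.cosh (t / 2)) * weilIncrement u t =
      (1 / 2) * ∫ t, 1 / (2 * Real.cosh (t / 2)) * weilIncrement u t := by
    have hsplit := intervalIntegral.integral_Iic_add_Ioi (hσD.integrableOn (s := Iic 0))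
      (hσD.integrableOn (s := Ioi 0))
    have hIic : ∫ t in Iic (0 : ℝ), 1 / (2 * Real.cosh (t / 2)) * weilIncrement u t =
        ∫ t in Ioi (0 : ℝ), 1 / (2 * Real.cosh (t / 2)) * weilIncrement u t := by
      have h := integral_comp_neg_Iic 0 (fun t : ℝ ↦ 1 / (2 * Real.cosh (t / 2)) * weilIncrement u t)
      simp only [neg_zero] at h
      rw [← h]
      refine setIntegral_congr_fun measurableSet_Iic fun t _ ↦ ?_
      rw [← heven t]
    rw [hIic] at hsplit; linarith
  have hfull : ∫ t, 1 / (2 * Real.cosh (t / 2)) * weilIncrement u t =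
      2 * N2 * π - 2 * ∫ t, 1 / (2 * Real.cosh (t / 2)) * (k t).re := by
    have : (fun t : ℝ ↦ 1 / (2 * Real.cosh (t / 2)) * weilIncrement u t) =
        fun t ↦ (2 * N2) * (1 / (2 * Real.cosh (t / 2))) - 2 * (1 / (2 * Real.cosh (t / 2)) * (k t).re) := by
      funext t; rw [hD t]; ring
    rw [this, integral_sub (hσi.const_mul _) (hσk.const_mul _), integral_const_mul, integral_const_mul, hσπ]
  rw [hhalf, hfull]; ring

/-- **The cosine pairing of the shift pairing is a sum of two squares**: for every `ω`,
`∫_ℝ cos(tω) Re k_u(t) dt = ‖∫ cos(ωy) u(y) dy‖² + ‖∫ sin(ωy) u(y) dy‖²`. -/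
theorem integral_cos_mul_re_shift (hm : Measurable u) (hz : ∀ x, x ∉ Icc (-a) a → u x = 0)
    (hb : ∀ x, ‖u x‖ ≤ S) (ω : ℝ) :
    ∫ t, Real.cos (t * ω) * (∫ x, u (x + t) * conj (u x)).re =
      ‖∫ y, (Real.cos (ω * y) : ℂ) * u y‖ ^ 2 + ‖∫ y, (Real.sin (ω * y) : ℂ) * u y‖ ^ 2 := by
  have hS : 0 ≤ S := (norm_nonneg _).trans (hb 0)
  have hui := integrable_window hm hz hb
  -- joint integrability of `(t, x) ↦ cos(tω) u(x+t) conj u(x)`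
  have hF : Integrable (Function.uncurry fun t x : ℝ ↦ (Real.cos (t * ω) : ℂ) * (u (x + t) * conj (u x)))
      (volume.prod volume) := by
    have hdom : Integrable (fun p : ℝ × ℝ ↦ (Icc (-(2 * a)) (2 * a)).indicator (fun _ ↦ S) p.1 *
        (Icc (-a) a).indicator (fun _ ↦ S) p.2) (volume.prod volume) := by
      refine Integrable.mul_prod ?_ ?_
      · exact (integrable_indicator_iff measurableSet_Icc).2 (integrableOn_const (by simp [Real.volume_Icc]))
      · exact (integrable_indicator_iff measurableSet_Icc).2 (integrableOn_const (by simp [Real.volume_Icc]))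
    refine hdom.mono' ?_ (Eventually.of_forall ?_)
    · exact ((Complex.measurable_ofReal.comp ((measurable_fst.mul_const ω).cos)).mul
        (measurable_shift_mul_conj_uncurry hm)).aestronglyMeasurable
    · rintro ⟨t, x⟩
      simp only [Function.uncurry_apply_pair]
      rw [norm_mul, Complex.norm_real, norm_mul, Complex.norm_conj]
      by_cases hx : x ∈ Icc (-a) a
      · by_cases ht : t ∈ Icc (-(2 * a)) (2 * a)
        · rw [indicator_of_mem ht, indicator_of_mem hx]
          calc ‖Real.cos (t * ω)‖ * (‖u (x + t)‖ * ‖u x‖) ≤ 1 * (S * S) :=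
                mul_le_mul (Real.abs_cos_le_one _) (mul_le_mul (hb _) (hb _) (norm_nonneg _) hS)
                  (by positivity) zero_le_one
            _ = S * S := one_mul _
        · have hxt : x + t ∉ Icc (-a) a := by
            intro h; apply ht
            exact ⟨by linarith [h.1, hx.2], by linarith [h.2, hx.1]⟩
          rw [hz _ hxt, norm_zero, zero_mul, mul_zero]
          exact mul_nonneg (Set.indicator_nonneg (fun _ _ ↦ hS) _) (Set.indicator_nonneg (fun _ _ ↦ hS) _)
      · rw [hz _ hx, norm_zero, mul_zero, mul_zero]
        exact mul_nonneg (Set.indicator_nonneg (fun _ _ ↦ hS) _) (Set.indicator_nonneg (fun _ _ ↦ hS) _)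
  have hint1 : Integrable fun t : ℝ ↦ (Real.cos (t * ω) : ℂ) * ∫ x, u (x + t) * conj (u x) := by
    refine hF.integral_prod_left.congr (Eventually.of_forall fun t ↦ ?_)
    simp only [Function.uncurry_apply_pair]
    rw [integral_const_mul]
  have hL : ∫ t, Real.cos (t * ω) * (∫ x, u (x + t) * conj (u x)).re =
      (∫ t, (Real.cos (t * ω) : ℂ) * ∫ x, u (x + t) * conj (u x)).re := by
    have h := integral_re hint1
    simp only [RCLike.re_to_complex, Complex.re_ofReal_mul] at h
    exact h
  rw [hL]
  have hswap : ∫ t, (Real.cos (t * ω) : ℂ) * ∫ x, u (x + t) * conj (u x) =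
      ∫ x, conj (u x) * ∫ y, (Real.cos ((y - x) * ω) : ℂ) * u y := by
    calc ∫ t, (Real.cos (t * ω) : ℂ) * ∫ x, u (x + t) * conj (u x)
        = ∫ t, ∫ x, (Real.cos (t * ω) : ℂ) * (u (x + t) * conj (u x)) := by
          refine integral_congr_ae (Eventually.of_forall fun t ↦ ?_); simp only; rw [integral_const_mul]
      _ = ∫ x, ∫ t, (Real.cos (t * ω) : ℂ) * (u (x + t) * conj (u x)) := integral_integral_swap hF
      _ = ∫ x, conj (u x) * ∫ y, (Real.cos ((y - x) * ω) : ℂ) * u y := by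
          refine integral_congr_ae (Eventually.of_forall fun x ↦ ?_)
          simp only
          rw [← integral_const_mul, ← integral_sub_right_eq_self _ x]
          refine integral_congr_ae (Eventually.of_forall fun y ↦ ?_)
          simp only
          rw [show x + (y - x) = y by ring]; ring
  rw [hswap]
  set C : ℂ := ∫ y, (Real.cos (ω * y) : ℂ) * u y with hC
  set Sn : ℂ := ∫ y, (Real.sin (ω * y) : ℂ) * u y with hSn
  have hci : Integrable fun y ↦ (Real.cos (ω * y) : ℂ) * u y := by
    refine (hui.norm).mono' ((Complex.measurable_ofReal.comp ((measurable_const.mul measurable_id).cos)).mul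
      hm).aestronglyMeasurable (Eventually.of_forall fun y ↦ ?_)
    rw [norm_mul, Complex.norm_real]
    exact mul_le_of_le_one_left (norm_nonneg _) (Real.abs_cos_le_one _)
  have hsi : Integrable fun y ↦ (Real.sin (ω * y) : ℂ) * u y := by
    refine (hui.norm).mono' ((Complex.measurable_ofReal.comp ((measurable_const.mul measurable_id).sin)).mul
      hm).aestronglyMeasurable (Eventually.of_forall fun y ↦ ?_)
    rw [norm_mul, Complex.norm_real]
    exact mul_le_of_le_one_left (norm_nonneg _) (Real.abs_sin_le_one _)
  have hinner : ∀ x : ℝ, ∫ y, (Real.cos ((y - x) * ω) : ℂ) * u y =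
      (Real.cos (ω * x) : ℂ) * C + (Real.sin (ω * x) : ℂ) * Sn := by
    intro x
    have : (fun y ↦ (Real.cos ((y - x) * ω) : ℂ) * u y) = fun y ↦
        (Real.cos (ω * x) : ℂ) * ((Real.cos (ω * y) : ℂ) * u y) +
          (Real.sin (ω * x) : ℂ) * ((Real.sin (ω * y) : ℂ) * u y) := by
      funext y
      rw [show (y - x) * ω = ω * y - ω * x by ring, Real.cos_sub]
      push_cast; ring
    rw [this, integral_add (hci.const_mul _) (hsi.const_mul _), integral_const_mul, integral_const_mul]
  simp_rw [hinner]
  have hcc : Integrable fun x ↦ conj ((Real.cos (ω * x) : ℂ) * u x) :=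
    (Complex.conjLIE.integrable_comp_iff.2 hci)
  have hsc : Integrable fun x ↦ conj ((Real.sin (ω * x) : ℂ) * u x) :=
    (Complex.conjLIE.integrable_comp_iff.2 hsi)
  have h1 : (fun x ↦ conj (u x) * ((Real.cos (ω * x) : ℂ) * C + (Real.sin (ω * x) : ℂ) * Sn)) =
      fun x ↦ C * conj ((Real.cos (ω * x) : ℂ) * u x) + Sn * conj ((Real.sin (ω * x) : ℂ) * u x) := by
    funext x; simp only [map_mul, Complex.conj_ofReal]; ring
  rw [h1, integral_add (hcc.const_mul C) (hsc.const_mul Sn), integral_const_mul, integral_const_mul,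
    integral_conj, integral_conj, ← hC, ← hSn, Complex.mul_conj, Complex.mul_conj, ← Complex.ofReal_add,
    Complex.ofReal_re, Complex.normSq_eq_norm_sq, Complex.normSq_eq_norm_sq]

/-- **THE PARITY BONUS AS A POSITIVE INTEGRAL**: for a bounded measurable `u` vanishing off `[-a,a]`,
`π‖u‖₂² − ∫₀^∞ D_t(u) dt/(2cosh(t/2)) = ∫_ℝ (‖∫cos(ωy)u(y)dy‖² + ‖∫sin(ωy)u(y)dy‖²) dω/(2cosh(πω))`. -/
theorem parity_bonus_eq (hm : Measurable u) (hz : ∀ x, x ∉ Icc (-a) a → u x = 0)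
    (hb : ∀ x, ‖u x‖ ≤ S) :
    π * (∫ x, ‖u x‖ ^ 2) - ∫ t in Ioi (0 : ℝ), 1 / (2 * Real.cosh (t / 2)) * weilIncrement u t =
      ∫ ω, (‖∫ y, (Real.cos (ω * y) : ℂ) * u y‖ ^ 2 + ‖∫ y, (Real.sin (ω * y) : ℂ) * u y‖ ^ 2) /
        (2 * Real.cosh (π * ω)) := by
  rw [parity_bonus_eq_integral_shift hm hz hb]
  set k : ℝ → ℂ := fun t ↦ ∫ x, u (x + t) * conj (u x) with hk
  have hkb : ∀ t, ‖(k t).re‖ ≤ S * ∫ x, ‖u x‖ := fun t ↦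
    (abs_re_le_norm _).trans (norm_shift_integral_le hm hz hb t)
  have hk0 : ∀ t, t ∉ Icc (-(2 * a)) (2 * a) → (k t).re = 0 := by
    intro t ht
    have : 2 * a < |t| := by
      rcases le_or_gt 0 t with h | h
      · rw [abs_of_nonneg h]; by_contra hle; exact ht ⟨by linarith, by linarith⟩
      · rw [abs_of_neg h]; by_contra hle; exact ht ⟨by linarith, by linarith⟩
    simp only [hk, shift_integral_eq_zero hz this, Complex.zero_re]
  have hkm : AEStronglyMeasurable (fun t ↦ (k t).re) :=
    Complex.continuous_re.comp_aestronglyMeasurable (aestronglyMeasurable_shift_integral hm)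
  -- Fubini for `(t, ω) ↦ w(ω) cos(tω) Re k(t)`
  have hG : Integrable (Function.uncurry fun t ω : ℝ ↦ 1 / (2 * Real.cosh (π * ω)) * Real.cos (t * ω) * (k t).re)
      (volume.prod volume) := by
    have hdom : Integrable (fun p : ℝ × ℝ ↦ (Icc (-(2 * a)) (2 * a)).indicator (fun _ ↦ S * ∫ x, ‖u x‖) p.1 *
        (1 / (2 * Real.cosh (π * p.2)))) (volume.prod volume) := by
      refine Integrable.mul_prod ?_ integrable_sech_weight
      exact (integrable_indicator_iff measurableSet_Icc).2 (integrableOn_const (by simp [Real.volume_Icc]))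
    refine hdom.mono' ?_ (Eventually.of_forall ?_)
    · have h1 : Measurable fun p : ℝ × ℝ ↦ 1 / (2 * Real.cosh (π * p.2)) :=
        measurable_const.div (measurable_const.mul (Real.measurable_cosh.comp (measurable_const.mul measurable_snd)))
      have h2 : Measurable fun p : ℝ × ℝ ↦ Real.cos (p.1 * p.2) := (measurable_fst.mul measurable_snd).cos
      exact ((h1.mul h2).aestronglyMeasurable).mul (hkm.comp_fst)  -- (k p.1).re
    · rintro ⟨t, ω⟩
      simp only [Function.uncurry_apply_pair]
      have hw := sech_weight_pos ω
      rw [norm_mul, norm_mul, Real.norm_of_nonneg hw.le]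
      by_cases ht : t ∈ Icc (-(2 * a)) (2 * a)
      · rw [indicator_of_mem ht]
        calc 1 / (2 * Real.cosh (π * ω)) * ‖Real.cos (t * ω)‖ * ‖(k t).re‖
            ≤ 1 / (2 * Real.cosh (π * ω)) * 1 * (S * ∫ x, ‖u x‖) :=
              mul_le_mul (mul_le_mul_of_nonneg_left (Real.abs_cos_le_one _) hw.le) (hkb t) (norm_nonneg _)
                (by positivity)
          _ = (S * ∫ x, ‖u x‖) * (1 / (2 * Real.cosh (π * ω))) := by ring
      · rw [hk0 t ht, norm_zero, mul_zero, indicator_of_notMem ht, zero_mul]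
  calc ∫ t, 1 / (2 * Real.cosh (t / 2)) * (k t).re
      = ∫ t, ∫ ω, 1 / (2 * Real.cosh (π * ω)) * Real.cos (t * ω) * (k t).re := by
        refine integral_congr_ae (Eventually.of_forall fun t ↦ ?_)
        simp only
        rw [sech_density_eq_integral_cos, ← integral_mul_const]
        refine integral_congr_ae (Eventually.of_forall fun ω ↦ ?_)
        simp only
        ring
    _ = ∫ ω, ∫ t, 1 / (2 * Real.cosh (π * ω)) * Real.cos (t * ω) * (k t).re := integral_integral_swap hG
    _ = ∫ ω, (‖∫ y, (Real.cos (ω * y) : ℂ) * u y‖ ^ 2 + ‖∫ y, (Real.sin (ω * y) : ℂ) * u y‖ ^ 2) /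
          (2 * Real.cosh (π * ω)) := by
        refine integral_congr_ae (Eventually.of_forall fun ω ↦ ?_)
        simp only
        have : (fun t ↦ 1 / (2 * Real.cosh (π * ω)) * Real.cos (t * ω) * (k t).re) =
            fun t ↦ 1 / (2 * Real.cosh (π * ω)) * (Real.cos (t * ω) * (k t).re) := by
          funext t; ring
        rw [this, integral_const_mul, integral_cos_mul_re_shift hm hz hb ω]
        ring

/-- **The parity bonus is non-negative** on bounded measurable functions vanishing off `[-a,a]`. -/
theorem parity_bonus_nonneg (hm : Measurable u) (hz : ∀ x, x ∉ Icc (-a) a → u x = 0)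
    (hb : ∀ x, ‖u x‖ ≤ S) :
    0 ≤ π * (∫ x, ‖u x‖ ^ 2) - ∫ t in Ioi (0 : ℝ), 1 / (2 * Real.cosh (t / 2)) * weilIncrement u t := by
  rw [parity_bonus_eq hm hz hb]
  exact integral_nonneg fun ω ↦ by have := Real.cosh_pos (π * ω); positivity

/-! ## Consequences: odd characters are certified by the even-parity matrices -/

/-- **Odd real χ: the twisted window form dominates the even-parity expression**, on trigonometric
windows: `𝓔^χ_a(Σ c_nχ_n) − M^χ_a‖Σ c_nχ_n‖₂² ≥ Σ_n Σ_m Re(conj c_n c_m)·twistedGramCoeff χ a n m`. -/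
theorem twistedWindowForm_sum_smul_chi_ge_twistedGramCoeff (χ : DirichletCharacter ℂ q)
    (hχ : ∀ n : ℕ, conj (χ (n : ZMod q)) = χ (n : ZMod q)) (hodd : charParity χ = 1) (ha : 0 < a)
    (s : Finset ℤ) (c : ℤ → ℂ) :
    ∑ n ∈ s, ∑ m ∈ s, (conj (c n) * c m).re * twistedGramCoeff χ a n m ≤
      weilDirichletEnergyChar χ a (∑ n ∈ s, c n • chi a n) -
        weilMarkovConstantChar χ a * ∫ x, ‖(∑ n ∈ s, c n • chi a n) x‖ ^ 2 := by
  rw [twistedWindowForm_eq_of_odd_real χ hχ hodd ha.le (measurable_sum_smul_chi _ _)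
    (fun x hx ↦ sum_smul_chi_eq_zero _ _ hx) (fun x ↦ norm_sum_smul_chi_le _ _ x)
    (fun x y hx hy ↦ norm_sum_smul_chi_sub_le ha _ _ hx hy),
    core_sum_smul_chi_eq_twistedGramCoeff χ ha s c]
  linarith [parity_bonus_nonneg (a := a) (measurable_sum_smul_chi s c)
    (fun x hx ↦ sum_smul_chi_eq_zero _ _ hx) (fun x ↦ norm_sum_smul_chi_le s c x)]

/-- **Odd real χ from the EVEN-parity matrix**: per-sector PSD of `twistedGramCoeff χ a` (Yoshida's
digamma-node entries, no `sech` block) for every `N` ⟹ `WeilPositivityOnChar χ a` (`q ≠ 1`, `a > 0`,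
`conj χ = χ`, `a_χ = 1`). -/
theorem weilPositivityOnChar_of_twistedGramCoeff_sector_psd_odd (hq : q ≠ 1) (χ : DirichletCharacter ℂ q)
    (hχ : ∀ n : ℕ, conj (χ (n : ZMod q)) = χ (n : ZMod q)) (hodd : charParity χ = 1) (ha : 0 < a)
    (hev : ∀ (N : ℕ) (y : ℕ → ℝ), 0 ≤ ∑ n ∈ Finset.range (N + 1), ∑ m ∈ Finset.range (N + 1),
      y n * y m * (if n = 0 then twistedGramCoeff χ a 0 m else if m = 0 then twistedGramCoeff χ a n 0
        else (twistedGramCoeff χ a n m + twistedGramCoeff χ a n (-(m : ℤ))) / 2))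
    (hod : ∀ (N : ℕ) (z : ℕ → ℝ), 0 ≤ ∑ k ∈ Finset.range N, ∑ l ∈ Finset.range N,
      z k * z l * ((twistedGramCoeff χ a ((k : ℤ) + 1) ((l : ℤ) + 1) -
        twistedGramCoeff χ a ((k : ℤ) + 1) (-((l : ℤ) + 1))) / 2)) :
    WeilPositivityOnChar χ a :=
  weilPositivityOnChar_of_twistedWindowForm_sum_chi_nonneg hq χ ha fun N c ↦
    (sum_modes_re_conj_mul_nonneg_of_sectors (twistedGramCoeff χ a) (twistedGramCoeff_neg_neg χ a)
      N (hev N) (hod N) c).trans (twistedWindowForm_sum_smul_chi_ge_twistedGramCoeff χ hχ hodd ha _ c)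

/-- **Odd complex χ from the EVEN-parity hermitian kernel**: hermitian PSD of `twistedGramCoeffC χ a` on
every `modes N` ⟹ `WeilPositivityOnChar χ a` (`q ≠ 1`, `a > 0`, `a_χ = 1`). -/
theorem weilPositivityOnChar_of_twistedGramCoeffC_psd_odd (hq : q ≠ 1) (χ : DirichletCharacter ℂ q)
    (hodd : charParity χ = 1) (ha : 0 < a)
    (hpsd : ∀ (N : ℕ) (c : ℤ → ℂ),
      0 ≤ ∑ n ∈ modes N, ∑ m ∈ modes N, (conj (c n) * c m * twistedGramCoeffC χ a n m).re) :
    WeilPositivityOnChar χ a :=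
  weilPositivityOnChar_of_twistedWindowForm_sum_chi_nonneg hq χ ha fun N c ↦ by
    rw [twistedWindowForm_eq_of_odd χ hodd ha.le (measurable_sum_smul_chi _ _)
      (fun x hx ↦ sum_smul_chi_eq_zero _ _ hx) (fun x ↦ norm_sum_smul_chi_le _ _ x)
      (fun x y hx hy ↦ norm_sum_smul_chi_sub_le ha _ _ hx hy),
      coreC_sum_smul_chi_eq_twistedGramCoeffC χ ha (modes N) c]
    linarith [hpsd N c, parity_bonus_nonneg (a := a) (measurable_sum_smul_chi (modes N) c)
      (fun x hx ↦ sum_smul_chi_eq_zero _ _ hx) (fun x ↦ norm_sum_smul_chi_le (modes N) c x)]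

end Summit.Ventures.WeilGRH

end
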